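import Mathlib
import Summits.ResolutionOfSingularities.ResolutionOfSingularities.Theorems.WeightedInvariantLocalWeightedDropNewtonSetChartLaws
import HarnessLib

/-!
# `WeightedInvariant.LocalWeightedDrop`, line `hasse-ridge-face-selection`: VERTICES of a point set `N ⊂ ℕ²` under the chart maps
# at a general scale `c` — a vertex of the image comes from a vertex of the source (`psi c`, `phiE c`), and shifts transport
# vertices both ways

Crux item stmt-ResolutionOfSingularities-8899 `LocalWeightedDrop` (route `ResolutionOfSingularities/WeightedInvariant`), serving
the door `WeightedConstruction` stmt-ResolutionOfSingularities-0571.  [OURS · L1 W4.3, chain w43, support typer res-L1-type-o7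
(seat res-D-pv-023): companion of `…NewtonSetChartLaws` (p499926) for the VERTEX predicate `MonicDescent.IsVertex` of
`…MonicDescentLabels`; generalises lead-1's `isVertex_of_isVertex_image` (`psi 2`, `…BlowOneLaws`) and
`isVertex_of_isVertex_image_phi` (`phi = phiE 2`, `…TransportLaws`) to any scale `c`.  Consumer: the S3ρ terminal normal form
M3 «vertex not solvable» of res-type-083 / res-D-pv-005 AS stub-7 at scale `d!` (a non-solvable vertex of the successor must be
the image of a vertex of the source), and the S3πM pure case.  MODEL: CJS LNM 2270 Lemma 12.1 (4) / 13.2 (1) («`v′` is a vertex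
… the initial form at `v′` is the transform of the initial form at `v`»), × the scale.  Pure combinatorics; NOT a statement of any
manuscript.]

* `isVertex_of_isVertex_image_psiC` — `psi c P` a vertex of `psi c '' N` for the weight `(w₀, w₁)` ⇒ `P` a vertex of `N` for
  `(w₀, w₀ + w₁)` (order `≥ c` on `N`);
* `isVertex_of_isVertex_image_phiEC` — the letter swap: weight `(w₀ + w₁, w₁)` upstairs;
* `isVertex_image_shift_iff` — for a shift `σ` (`σP₀ + c = P₀`, `σP₁ = P₁` on `N`) vertices correspond for the SAME weight; mirror
  `isVertex_image_shift₂_iff`.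
[cite: CossartJannsenSaito2020, Lemma 12.1 (4), Lemma 13.2 (1)] [folklore]
-/

set_option linter.dupNamespace false -- mandated namespace of this single-conjunct summit

namespace Summit.ResolutionOfSingularities.ResolutionOfSingularities.Theorems

namespace MonicDescent

open Literature.RingTheory.TwoVariableSeries

variable {N : Set (Fin 2 →₀ ℕ)} {c : ℕ}

/-- The weight of `psi c R` for `(w₀, w₁)` plus `c·w₀` is the weight of `R` for `(w₀, w₀ + w₁)` (order `≥ c`). -/
theorem weight_psiC_add (w : Fin 2 → ℕ) {R : Fin 2 →₀ ℕ} (hR : c ≤ R 0 + R 1) :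
    Finsupp.weight w (psi c R) + c * w 0 = Finsupp.weight (fun i : Fin 2 => if i = 0 then w 0 else w 0 + w 1) R := by
  rw [Finsupp.weight_apply, Finsupp.weight_apply, Finsupp.sum_fintype _ _ (by simp), Finsupp.sum_fintype _ _ (by simp)]
  simp only [Fin.sum_univ_two, smul_eq_mul, psi_apply_zero, psi_apply_one]
  simp
  have : (R 0 + R 1 - c) * w 0 + c * w 0 = (R 0 + R 1) * w 0 := by
    rw [← Nat.add_mul]; congr 1; omega
  nlinarith [this]

/-- **A VERTEX OF `psi c '' N` COMES FROM A VERTEX OF `N`**: if `psi c P` is a vertex of the image for the weight `(w₀, w₁)` then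
`P` is a vertex of `N` for `(w₀, w₀ + w₁)` (all points of `N` of order `≥ c`). [cite: CossartJannsenSaito2020, Lemma 12.1 (4)] -/
theorem isVertex_of_isVertex_image_psiC (hNc : ∀ P ∈ N, c ≤ P 0 + P 1) {P : Fin 2 →₀ ℕ} (hP : P ∈ N)
    (hv : IsVertex (psi c '' N) (psi c P)) : IsVertex N P := by
  obtain ⟨-, w, hw, hmin⟩ := hv
  refine ⟨hP, fun i => if i = 0 then w 0 else w 0 + w 1, fun i => ?_, fun Q hQ hne => ?_⟩
  · fin_cases i
    · exact hw 0
    · exact Nat.add_pos_left (hw 0) _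
  have hPs := hNc P hP
  have hQs := hNc Q hQ
  have hneq : psi c Q ≠ psi c P := fun h => hne (psi_injOn c hQs hPs h)
  have hlt := hmin (psi c Q) ⟨Q, hQ, rfl⟩ hneq
  have := weight_psiC_add w hPs
  have := weight_psiC_add w hQs
  omega

/-- The weight of `phiE c R` for `(w₀, w₁)` plus `c·w₁` is the weight of `R` for `(w₀ + w₁, w₁)` (order `≥ c`). -/
theorem weight_phiEC_add (w : Fin 2 → ℕ) {R : Fin 2 →₀ ℕ} (hR : c ≤ R 0 + R 1) :
    Finsupp.weight w (phiE c R) + c * w 1 = Finsupp.weight (fun i : Fin 2 => if i = 0 then w 0 + w 1 else w 1) R := by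
  rw [Finsupp.weight_apply, Finsupp.weight_apply, Finsupp.sum_fintype _ _ (by simp), Finsupp.sum_fintype _ _ (by simp)]
  simp only [Fin.sum_univ_two, smul_eq_mul, phiE_apply_zero, phiE_apply_one]
  simp
  have : (R 0 + R 1 - c) * w 1 + c * w 1 = (R 0 + R 1) * w 1 := by
    rw [← Nat.add_mul]; congr 1; omega
  nlinarith [this]

/-- **A VERTEX OF `phiE c '' N` COMES FROM A VERTEX OF `N`** (weight `(w₀ + w₁, w₁)` upstairs). [cite: CossartJannsenSaito2020, Lemma 12.2] -/
theorem isVertex_of_isVertex_image_phiEC (hNc : ∀ P ∈ N, c ≤ P 0 + P 1) {P : Fin 2 →₀ ℕ} (hP : P ∈ N)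
    (hv : IsVertex (phiE c '' N) (phiE c P)) : IsVertex N P := by
  obtain ⟨-, w, hw, hmin⟩ := hv
  refine ⟨hP, fun i => if i = 0 then w 0 + w 1 else w 1, fun i => ?_, fun Q hQ hne => ?_⟩
  · fin_cases i
    · exact Nat.add_pos_left (hw 0) _
    · exact hw 1
  have hPs := hNc P hP
  have hQs := hNc Q hQ
  have hneq : phiE c Q ≠ phiE c P := fun h => hne (phiE_injOn c hQs hPs h)
  have hlt := hmin (phiE c Q) ⟨Q, hQ, rfl⟩ hneq
  have := weight_phiEC_add w hPs
  have := weight_phiEC_add w hQs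
  omega

/-! ## Shifts: vertices correspond for the same weight -/

section ShiftFirst

variable {σ : (Fin 2 →₀ ℕ) → (Fin 2 →₀ ℕ)} (h0 : ∀ P ∈ N, σ P 0 + c = P 0) (h1 : ∀ P ∈ N, σ P 1 = P 1)
include h0 h1

/-- A first-coordinate shift is injective on `N`. -/
theorem shift_injOn : Set.InjOn σ N := by
  intro P hP Q hQ h
  have e0 : σ P 0 = σ Q 0 := by rw [h]
  have e1 : σ P 1 = σ Q 1 := by rw [h]
  have := h0 P hP; have := h0 Q hQ; have := h1 P hP; have := h1 Q hQ
  exact finsupp_fin2_ext (by omega) (by omega)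

/-- The weight drops by the constant `c·w₀` under a first-coordinate shift. -/
theorem weight_shift_add (w : Fin 2 → ℕ) {R : Fin 2 →₀ ℕ} (hR : R ∈ N) :
    Finsupp.weight w (σ R) + c * w 0 = Finsupp.weight w R := by
  rw [Finsupp.weight_apply, Finsupp.weight_apply, Finsupp.sum_fintype _ _ (by simp), Finsupp.sum_fintype _ _ (by simp)]
  simp only [Fin.sum_univ_two, smul_eq_mul]
  have e0 := h0 R hR
  have e1 := h1 R hR
  rw [e1, ← e0]
  ring

/-- **VERTICES CORRESPOND UNDER A SHIFT** (same weight): `σ P` is a vertex of `σ '' N` iff `P` is a vertex of `N`. [folklore] -/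
theorem isVertex_image_shift_iff {P : Fin 2 →₀ ℕ} (hP : P ∈ N) : IsVertex (σ '' N) (σ P) ↔ IsVertex N P := by
  constructor
  · rintro ⟨-, w, hw, hmin⟩
    refine ⟨hP, w, hw, fun Q hQ hne => ?_⟩
    have hneq : σ Q ≠ σ P := fun h => hne (shift_injOn h0 h1 hQ hP h)
    have hlt := hmin (σ Q) ⟨Q, hQ, rfl⟩ hneq
    have := weight_shift_add h0 h1 w hP
    have := weight_shift_add h0 h1 w hQ
    omega
  · rintro ⟨-, w, hw, hmin⟩
    refine ⟨⟨P, hP, rfl⟩, w, hw, ?_⟩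
    rintro _ ⟨Q, hQ, rfl⟩ hne
    have hneq : Q ≠ P := fun h => hne (by rw [h])
    have hlt := hmin Q hQ hneq
    have := weight_shift_add h0 h1 w hP
    have := weight_shift_add h0 h1 w hQ
    omega

end ShiftFirst

section ShiftSecond

variable {σ : (Fin 2 →₀ ℕ) → (Fin 2 →₀ ℕ)} (h0 : ∀ P ∈ N, σ P 0 = P 0) (h1 : ∀ P ∈ N, σ P 1 + c = P 1)
include h0 h1

/-- A second-coordinate shift is injective on `N`. -/
theorem shift₂_injOn : Set.InjOn σ N := by
  intro P hP Q hQ h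
  have e0 : σ P 0 = σ Q 0 := by rw [h]
  have e1 : σ P 1 = σ Q 1 := by rw [h]
  have := h0 P hP; have := h0 Q hQ; have := h1 P hP; have := h1 Q hQ
  exact finsupp_fin2_ext (by omega) (by omega)

/-- The weight drops by the constant `c·w₁` under a second-coordinate shift. -/
theorem weight_shift₂_add (w : Fin 2 → ℕ) {R : Fin 2 →₀ ℕ} (hR : R ∈ N) :
    Finsupp.weight w (σ R) + c * w 1 = Finsupp.weight w R := by
  rw [Finsupp.weight_apply, Finsupp.weight_apply, Finsupp.sum_fintype _ _ (by simp), Finsupp.sum_fintype _ _ (by simp)]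
  simp only [Fin.sum_univ_two, smul_eq_mul]
  have e0 := h0 R hR
  have e1 := h1 R hR
  rw [e0, ← e1]
  ring

/-- **VERTICES CORRESPOND UNDER A SHIFT** of the second coordinate (same weight). [folklore] -/
theorem isVertex_image_shift₂_iff {P : Fin 2 →₀ ℕ} (hP : P ∈ N) : IsVertex (σ '' N) (σ P) ↔ IsVertex N P := by
  constructor
  · rintro ⟨-, w, hw, hmin⟩
    refine ⟨hP, w, hw, fun Q hQ hne => ?_⟩
    have hneq : σ Q ≠ σ P := fun h => hne (shift₂_injOn h0 h1 hQ hP h)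
    have hlt := hmin (σ Q) ⟨Q, hQ, rfl⟩ hneq
    have := weight_shift₂_add h0 h1 w hP
    have := weight_shift₂_add h0 h1 w hQ
    omega
  · rintro ⟨-, w, hw, hmin⟩
    refine ⟨⟨P, hP, rfl⟩, w, hw, ?_⟩
    rintro _ ⟨Q, hQ, rfl⟩ hne
    have hneq : Q ≠ P := fun h => hne (by rw [h])
    have hlt := hmin Q hQ hneq
    have := weight_shift₂_add h0 h1 w hP
    have := weight_shift₂_add h0 h1 w hQ
    omega

end ShiftSecond

end MonicDescent

end Summit.ResolutionOfSingularities.ResolutionOfSingularities.Theorems
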